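import Literature.NumberTheory.LFunctions.WeilTwoPrimeDeflL2Def
import Literature.NumberTheory.LFunctions.WeilTwoPrimeDeflL2DataPO24
import Literature.NumberTheory.LFunctions.WeilBlockRowsR
import HarnessLib

/-!
# Deflated two-prime certificate L2: the materialized odd block agrees with `P_r + Σ μ ĉ ĉᵀ`, rows 70–79

`WeilCert.checkPmRowG` for certificate L2 (odd block), by `decide +kernel`. Pure proof file; nothing is asserted.
-/

noncomputable section

namespace Literature.NumberTheory.LFunctions

set_option maxHeartbeats 0 in
/-- Row 70 of the materialized odd block is row 70 of `P_r + Σ μ ĉ ĉᵀ` (certificate L2). [folklore] -/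
theorem checkPmRowG1_70_weilCertDeflL2 : weilCertDeflL2Base.checkPmRowG weilCertDeflL2P weilCertDeflL2PmO 1 70 = true := by
  decide +kernel

set_option maxHeartbeats 0 in
/-- Row 71 of the materialized odd block is row 71 of `P_r + Σ μ ĉ ĉᵀ` (certificate L2). [folklore] -/
theorem checkPmRowG1_71_weilCertDeflL2 : weilCertDeflL2Base.checkPmRowG weilCertDeflL2P weilCertDeflL2PmO 1 71 = true := by
  decide +kernel

set_option maxHeartbeats 0 in
/-- Row 72 of the materialized odd block is row 72 of `P_r + Σ μ ĉ ĉᵀ` (certificate L2). [folklore] -/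
theorem checkPmRowG1_72_weilCertDeflL2 : weilCertDeflL2Base.checkPmRowG weilCertDeflL2P weilCertDeflL2PmO 1 72 = true := by
  decide +kernel

set_option maxHeartbeats 0 in
/-- Row 73 of the materialized odd block is row 73 of `P_r + Σ μ ĉ ĉᵀ` (certificate L2). [folklore] -/
theorem checkPmRowG1_73_weilCertDeflL2 : weilCertDeflL2Base.checkPmRowG weilCertDeflL2P weilCertDeflL2PmO 1 73 = true := by
  decide +kernel

set_option maxHeartbeats 0 in
/-- Row 74 of the materialized odd block is row 74 of `P_r + Σ μ ĉ ĉᵀ` (certificate L2). [folklore] -/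
theorem checkPmRowG1_74_weilCertDeflL2 : weilCertDeflL2Base.checkPmRowG weilCertDeflL2P weilCertDeflL2PmO 1 74 = true := by
  decide +kernel

set_option maxHeartbeats 0 in
/-- Row 75 of the materialized odd block is row 75 of `P_r + Σ μ ĉ ĉᵀ` (certificate L2). [folklore] -/
theorem checkPmRowG1_75_weilCertDeflL2 : weilCertDeflL2Base.checkPmRowG weilCertDeflL2P weilCertDeflL2PmO 1 75 = true := by
  decide +kernel

set_option maxHeartbeats 0 in
/-- Row 76 of the materialized odd block is row 76 of `P_r + Σ μ ĉ ĉᵀ` (certificate L2). [folklore] -/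
theorem checkPmRowG1_76_weilCertDeflL2 : weilCertDeflL2Base.checkPmRowG weilCertDeflL2P weilCertDeflL2PmO 1 76 = true := by
  decide +kernel

set_option maxHeartbeats 0 in
/-- Row 77 of the materialized odd block is row 77 of `P_r + Σ μ ĉ ĉᵀ` (certificate L2). [folklore] -/
theorem checkPmRowG1_77_weilCertDeflL2 : weilCertDeflL2Base.checkPmRowG weilCertDeflL2P weilCertDeflL2PmO 1 77 = true := by
  decide +kernel

set_option maxHeartbeats 0 in
/-- Row 78 of the materialized odd block is row 78 of `P_r + Σ μ ĉ ĉᵀ` (certificate L2). [folklore] -/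
theorem checkPmRowG1_78_weilCertDeflL2 : weilCertDeflL2Base.checkPmRowG weilCertDeflL2P weilCertDeflL2PmO 1 78 = true := by
  decide +kernel

set_option maxHeartbeats 0 in
/-- Row 79 of the materialized odd block is row 79 of `P_r + Σ μ ĉ ĉᵀ` (certificate L2). [folklore] -/
theorem checkPmRowG1_79_weilCertDeflL2 : weilCertDeflL2Base.checkPmRowG weilCertDeflL2P weilCertDeflL2PmO 1 79 = true := by
  decide +kernel


end Literature.NumberTheory.LFunctions
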